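import Mathlib
import Literature.Computability.Complexity.SymPlus
import Literature.Computability.Complexity.BoolEncodings

/-!
# Stub `stub_separable_split` (line Sketch, crux CircuitNpAcc0, separable rung R-B)

Let `S` be a SEPARABLE `SYM⁺` term system on `n` variables: every AND-term lies inside the low
half `i < h` (`h = n / 2`) or inside the high half `h ≤ i`. Write `u x = N((List.ofFn x).take h)`
and `w x = N((List.ofFn x).drop h)` for the little-endian values (`bitsToNat`) of the two blocks of
an input `x : Fin n → Bool`, so `u x < 2 ^ h`, `w x < 2 ^ (n - h)`. Then

* the number of satisfied terms splits as `count_S x = R₁ (u x) + R₂ (w x)`, where `R₁ u` counts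
  the low terms (`∀ i ∈ t, i < h`, so the empty term is low) all of whose positions are set bits
  of `u`, and `R₂ w` counts the remaining terms all of whose positions, shifted down by `h`, are
  set bits of `w` (`sepSplit_count_eq`); plainly `R₁ ≤ #terms = size`;
* `x ↦ (u x, w x)` is a bijection of the cube with `[0, 2^h) × [0, 2^(n-h))`, the inverse gluing
  binary digits (`Nat.testBit`; `sepSplit_glue_lo_hi`, `sepSplit_lo_glue`, `sepSplit_hi_glue`);

so every level-set sum of `χ₂ x = (u x | 2 w x + 1)` over `{x | count_S x = v}` is the integer
double sum `Σ_{u < 2^h} Σ_{w < 2^(n-h)} [R₁ u + R₂ w = v] (u | 2w+1)` (`stub_separable_split`,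
via `Finset.sum_nbij'`). Elementary; sorry-free.
-/

set_option linter.dupNamespace false -- `Summit.PneNP.PneNP.…`: summit = sub-problem (D-0017)

namespace Summit.PneNP.PneNP.Theorems.CircuitNpAcc0

open Finset Literature.Computability.Complexity

/-! ### Bits of the two block values

No auxiliary definitions (a `Theorems/` file with new `def`s is review-queued): the low block value
is spelled `bitsToNat ((List.ofFn x).take (n / 2))`, the high one `bitsToNat ((List.ofFn x).drop
(n / 2))`, the gluing map `fun i => if i < n / 2 then u.testBit i else w.testBit (i - n / 2)`. -/

-- adapted from Literature/Computability/AlgebraicComplexity/EsymmFromProductBits.lean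
-- (`testBit_bitsToNat'`; the public copy `Com.testBit_bitsToNat` sits under the stack machines)
/-- `testBit` of a little-endian numeral reads the list (default `false` past the end). -/
private theorem sepSplit_testBit_bitsToNat :
    ∀ (l : List Bool) (i : ℕ), (bitsToNat l).testBit i = l.getD i false
  | [], i => by simp
  | b :: l, 0 => by cases b <;> simp [Nat.testBit_zero, Nat.add_mod]
  | b :: l, i + 1 => by
    rw [bitsToNat_cons, Nat.testBit_add_one, List.getD_cons_succ, ← sepSplit_testBit_bitsToNat l i]
    cases b <;> simp [Nat.add_mul_div_left]

/-- Bit `i` of the low block value `N((List.ofFn x).take (n / 2))` is `x i` for `i < n / 2` and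
`0` beyond. -/
private theorem sepSplit_testBit_lo {n : ℕ} (x : Fin n → Bool) (i : ℕ) :
    (bitsToNat ((List.ofFn x).take (n / 2))).testBit i =
      if hi : i < n / 2 then x ⟨i, lt_of_lt_of_le hi (Nat.div_le_self n 2)⟩ else false := by
  rw [sepSplit_testBit_bitsToNat, List.getD_eq_getElem?_getD, List.getElem?_take,
    List.getElem?_ofFn]
  by_cases hi : i < n / 2
  · have hin : i < n := lt_of_lt_of_le hi (Nat.div_le_self n 2)
    simp [hi, hin]
  · simp [hi]

/-- Bit `j` of the high block value `N((List.ofFn x).drop (n / 2))` is `x (n / 2 + j)` while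
`n / 2 + j < n` and `0` beyond. -/
private theorem sepSplit_testBit_hi {n : ℕ} (x : Fin n → Bool) (j : ℕ) :
    (bitsToNat ((List.ofFn x).drop (n / 2))).testBit j =
      if hj : n / 2 + j < n then x ⟨n / 2 + j, hj⟩ else false := by
  rw [sepSplit_testBit_bitsToNat, List.getD_eq_getElem?_getD, List.getElem?_drop,
    List.getElem?_ofFn]
  by_cases hj : n / 2 + j < n <;> simp [hj]

/-- Bits of the low block value at low positions of `Fin n`. -/
private theorem sepSplit_testBit_lo_fin {n : ℕ} (x : Fin n → Bool) (i : Fin n)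
    (hi : (i : ℕ) < n / 2) : (bitsToNat ((List.ofFn x).take (n / 2))).testBit i = x i := by
  rw [sepSplit_testBit_lo, dif_pos hi]

/-- Bits of the high block value at (shifted) high positions of `Fin n`. -/
private theorem sepSplit_testBit_hi_fin {n : ℕ} (x : Fin n → Bool) (i : Fin n)
    (hi : n / 2 ≤ (i : ℕ)) :
    (bitsToNat ((List.ofFn x).drop (n / 2))).testBit (i - n / 2) = x i := by
  have h1 : n / 2 + ((i : ℕ) - n / 2) < n := by have := i.isLt; omega
  rw [sepSplit_testBit_hi, dif_pos h1]
  congr 1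
  exact Fin.ext (show n / 2 + ((i : ℕ) - n / 2) = (i : ℕ) by omega)

/-- The low block value is below `2 ^ (n / 2)`. -/
private theorem sepSplit_lo_lt {n : ℕ} (x : Fin n → Bool) :
    bitsToNat ((List.ofFn x).take (n / 2)) < 2 ^ (n / 2) := by
  have h := bitsToNat_lt ((List.ofFn x).take (n / 2))
  rwa [List.length_take, List.length_ofFn, Nat.min_eq_left (Nat.div_le_self n 2)] at h

/-- The high block value is below `2 ^ (n - n / 2)`. -/
private theorem sepSplit_hi_lt {n : ℕ} (x : Fin n → Bool) :
    bitsToNat ((List.ofFn x).drop (n / 2)) < 2 ^ (n - n / 2) := by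
  have h := bitsToNat_lt ((List.ofFn x).drop (n / 2))
  rwa [List.length_drop, List.length_ofFn] at h

/-- Left inverse: gluing the binary digits of the two block values of `x` gives back `x`. -/
private theorem sepSplit_glue_lo_hi {n : ℕ} (x : Fin n → Bool) :
    (fun i : Fin n => if (i : ℕ) < n / 2 then (bitsToNat ((List.ofFn x).take (n / 2))).testBit i
      else (bitsToNat ((List.ofFn x).drop (n / 2))).testBit (i - n / 2)) = x := by
  funext i
  show (if (i : ℕ) < n / 2 then _ else _) = x i
  split_ifs with hi
  · exact sepSplit_testBit_lo_fin x i hi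
  · exact sepSplit_testBit_hi_fin x i (not_lt.1 hi)

/-- Right inverse, low block: for `u < 2 ^ (n / 2)` the low block value of the glued digit
string of `(u, w)` is `u`. -/
private theorem sepSplit_lo_glue {n u w : ℕ} (hu : u < 2 ^ (n / 2)) :
    bitsToNat ((List.ofFn fun i : Fin n =>
      if (i : ℕ) < n / 2 then u.testBit i else w.testBit (i - n / 2)).take (n / 2)) = u := by
  refine Nat.eq_of_testBit_eq fun i => ?_
  rw [sepSplit_testBit_lo]
  by_cases hi : i < n / 2
  · rw [dif_pos hi]
    exact if_pos hi
  · rw [dif_neg hi]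
    exact (Nat.testBit_lt_two_pow
      (lt_of_lt_of_le hu (Nat.pow_le_pow_right (by norm_num) (not_lt.1 hi)))).symm

/-- Right inverse, high block: for `w < 2 ^ (n - n / 2)` the high block value of the glued digit
string of `(u, w)` is `w`. -/
private theorem sepSplit_hi_glue {n u w : ℕ} (hw : w < 2 ^ (n - n / 2)) :
    bitsToNat ((List.ofFn fun i : Fin n =>
      if (i : ℕ) < n / 2 then u.testBit i else w.testBit (i - n / 2)).drop (n / 2)) = w := by
  refine Nat.eq_of_testBit_eq fun j => ?_
  rw [sepSplit_testBit_hi]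
  by_cases hj : n / 2 + j < n
  · rw [dif_pos hj]
    show (if n / 2 + j < n / 2 then u.testBit (n / 2 + j) else w.testBit (n / 2 + j - n / 2)) =
      w.testBit j
    rw [if_neg (by omega), Nat.add_sub_cancel_left]
  · rw [dif_neg hj]
    exact (Nat.testBit_lt_two_pow
      (lt_of_lt_of_le hw (Nat.pow_le_pow_right (by norm_num) (by omega)))).symm

/-! ### The count splits -/

/-- Arithmetic of one induction step: the indicator of `P` is the sum of the indicators of `Q`
and `R` when exactly one of (`P, Q, ¬R`), (`P, ¬Q, R`), (`¬P, ¬Q, ¬R`) holds. -/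
private theorem sepSplit_ite_step {P Q R : Bool} (a b : ℕ)
    (h : (P = true ∧ Q = true ∧ R = false) ∨ (P = true ∧ Q = false ∧ R = true) ∨
      (P = false ∧ Q = false ∧ R = false)) :
    a + b + (if P then 1 else 0) = (a + if Q then 1 else 0) + (b + if R then 1 else 0) := by
  rcases h with ⟨rfl, rfl, rfl⟩ | ⟨rfl, rfl, rfl⟩ | ⟨rfl, rfl, rfl⟩ <;> simp <;> omega

/-- **The count splits** for a separable system: `count_S x = R₁ (u x) + R₂ (w x)`, where `R₁ u`
counts the low terms (`∀ i ∈ t, i < n / 2`; the empty term is low) all of whose positions are set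
bits of `u`, and `R₂ w` the remaining terms all of whose positions shifted down by `n / 2` are set
bits of `w`. Indeed a low term is satisfied iff its positions are set bits of `u x`; any other
term is high, and is satisfied iff its shifted positions are set bits of `w x`. -/
private theorem sepSplit_count_eq {n : ℕ} (S : SymPlus n)
    (hS : ∀ t ∈ S.terms, (∀ i ∈ t, (i : ℕ) < n / 2) ∨ (∀ i ∈ t, n / 2 ≤ (i : ℕ)))
    (x : Fin n → Bool) :
    S.count x =
      (S.terms.countP fun t : Finset (Fin n) => decide ((∀ i ∈ t, (i : ℕ) < n / 2) ∧
          ∀ i ∈ t, (bitsToNat ((List.ofFn x).take (n / 2))).testBit i = true)) +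
      (S.terms.countP fun t : Finset (Fin n) => decide (¬ (∀ i ∈ t, (i : ℕ) < n / 2) ∧
          ∀ i ∈ t, (bitsToNat ((List.ofFn x).drop (n / 2))).testBit (i - n / 2) = true)) := by
  unfold SymPlus.count
  generalize S.terms = L at hS ⊢
  induction L with
  | nil => simp
  | cons t L ih =>
    rw [List.countP_cons, List.countP_cons, List.countP_cons,
      ih fun s hs => hS s (List.mem_cons_of_mem t hs)]
    apply sepSplit_ite_step
    by_cases hlow : ∀ i ∈ t, (i : ℕ) < n / 2
    · -- a low term: satisfied iff its positions are set bits of `u x`; never counted by `R₂`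
      have e : (∀ i ∈ t, x i = true) ↔
          ∀ i ∈ t, (bitsToNat ((List.ofFn x).take (n / 2))).testBit i = true :=
        forall₂_congr fun i hi => by rw [sepSplit_testBit_lo_fin x i (hlow i hi)]
      have hR : ¬ (¬ (∀ i ∈ t, (i : ℕ) < n / 2) ∧
          ∀ i ∈ t, (bitsToNat ((List.ofFn x).drop (n / 2))).testBit (i - n / 2) = true) :=
        fun h => h.1 hlow
      by_cases hP : ∀ i ∈ t, x i = true
      · exact Or.inl ⟨decide_eq_true hP, decide_eq_true ⟨hlow, e.1 hP⟩, decide_eq_false hR⟩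
      · exact Or.inr (Or.inr ⟨decide_eq_false hP,
          decide_eq_false fun h => hP (e.2 h.2), decide_eq_false hR⟩)
    · -- a non-low term is high: satisfied iff its shifted positions are set bits of `w x`
      have hhigh : ∀ i ∈ t, n / 2 ≤ (i : ℕ) := (hS t List.mem_cons_self).resolve_left hlow
      have e : (∀ i ∈ t, x i = true) ↔
          ∀ i ∈ t, (bitsToNat ((List.ofFn x).drop (n / 2))).testBit (i - n / 2) = true :=
        forall₂_congr fun i hi => by rw [sepSplit_testBit_hi_fin x i (hhigh i hi)]
      have hQ : ¬ ((∀ i ∈ t, (i : ℕ) < n / 2) ∧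
          ∀ i ∈ t, (bitsToNat ((List.ofFn x).take (n / 2))).testBit i = true) :=
        fun h => hlow h.1
      by_cases hP : ∀ i ∈ t, x i = true
      · exact Or.inr (Or.inl ⟨decide_eq_true hP, decide_eq_false hQ, decide_eq_true ⟨hlow, e.1 hP⟩⟩)
      · exact Or.inr (Or.inr ⟨decide_eq_false hP, decide_eq_false hQ,
          decide_eq_false fun h => hP (e.2 h.2)⟩)

/-! ### The stub -/

/-- RUNG STUB R-B (`stub_separable_split`): for a SEPARABLE term system (every AND-term lies
inside the low half `i < n/2` or inside the high half `n/2 ≤ i`), the count splits as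
`R₁(u) + R₂(w)` along the bijection `x ↦ (u, w) = (N(low half), N(high half))` of `Fin n → Bool`
with `[0, 2^{n/2}) × [0, 2^{n-n/2})`, `R₁ ≤ size`, so every level-set character sum is an
integer double sum. -/
theorem stub_separable_split : ∀ {n : ℕ} (S : SymPlus n),
    (∀ t ∈ S.terms, (∀ i ∈ t, (i : ℕ) < n / 2) ∨ (∀ i ∈ t, n / 2 ≤ (i : ℕ))) →
    ∃ R₁ R₂ : ℕ → ℕ, (∀ u, R₁ u ≤ S.size) ∧ ∀ v : ℕ,
      ∑ x ∈ univ.filter (fun x : Fin n → Bool => S.count x = v),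
        jacobiSym (↑(bitsToNat ((List.ofFn x).take ((List.ofFn x).length / 2))))
          (2 * bitsToNat ((List.ofFn x).drop ((List.ofFn x).length / 2)) + 1) =
      ∑ u ∈ range (2 ^ (n / 2)), ∑ w ∈ range (2 ^ (n - n / 2)),
        if R₁ u + R₂ w = v then jacobiSym (u : ℤ) (2 * w + 1) else 0 := by
  intro n S hS
  -- `R₁ u` = #{low terms with all positions set in `u`}, `R₂ w` = #{other terms, shifted, in `w`}
  refine ⟨fun u => S.terms.countP fun t : Finset (Fin n) =>
      decide ((∀ i ∈ t, (i : ℕ) < n / 2) ∧ ∀ i ∈ t, u.testBit i = true),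
    fun w => S.terms.countP fun t : Finset (Fin n) =>
      decide (¬ (∀ i ∈ t, (i : ℕ) < n / 2) ∧ ∀ i ∈ t, w.testBit (i - n / 2) = true),
    fun _ => List.countP_le_length, fun v => ?_⟩
  simp only [List.length_ofFn]
  rw [Finset.sum_filter]
  refine Eq.trans ?_ (Finset.sum_product' (range (2 ^ (n / 2))) (range (2 ^ (n - n / 2))) _)
  -- reindex along `x ↦ (u x, w x)`, inverse = glue the binary digits
  refine Finset.sum_nbij'
    (fun x : Fin n → Bool =>
      (bitsToNat ((List.ofFn x).take (n / 2)), bitsToNat ((List.ofFn x).drop (n / 2))))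
    (fun p : ℕ × ℕ => fun i : Fin n =>
      if (i : ℕ) < n / 2 then p.1.testBit i else p.2.testBit (i - n / 2))
    ?_ ?_ ?_ ?_ ?_
  · intro x _
    exact Finset.mem_product.2
      ⟨Finset.mem_range.2 (sepSplit_lo_lt x), Finset.mem_range.2 (sepSplit_hi_lt x)⟩
  · intro p _
    exact Finset.mem_univ _
  · intro x _
    exact sepSplit_glue_lo_hi x
  · rintro ⟨u, w⟩ hp
    simp only [Finset.mem_product, Finset.mem_range] at hp
    exact Prod.ext (sepSplit_lo_glue hp.1) (sepSplit_hi_glue hp.2)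
  · intro x _
    rw [sepSplit_count_eq S hS x]

end Summit.PneNP.PneNP.Theorems.CircuitNpAcc0
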